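import Summits.HodgeConjecture.HodgeConjecture.Theorems.Ring2AbelianAllWeilFloor
import Summits.HodgeConjecture.HodgeConjecture.Theorems.Ring2AbelianAllWeilIsogenyDescent
import Literature.AlgebraicGeometry.HodgeTheory.WeilClassesRationalPlane
import Literature.AlgebraicGeometry.HodgeTheory.HodgeTypeExteriorProduct
import Literature.AlgebraicGeometry.HodgeTheory.HodgeConjectureQbarVoisinProofs
import Literature.AlgebraicGeometry.Motives.AbelianVarietyIsogenyProofs
import HarnessLib

/-!
# Ring 2 / AbelianAll — the Weil-fourfold residual is a statement about squarefree discriminants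

research route, not a corollary; conditional on HC_CM plus one named minimal statement.
Cell line: research route conditional on HC_CM; not a corollary; Q11.4-sentence-2 already refuted in dim ≥ 3.
`HC_CM` (`Theses.RankFourFaces.CMAbelianHodge`) does not occur in this file; no case of the Hodge conjecture is claimed.

Helper file of the publication unit `pub-hodge-ring2` (seat ab-weil-1, gen 4), supporting
`stmt-HodgeConjecture-16267`. Research route, not a corollary; conditional statements keep their
hypotheses as binders, and the residual below is a HYPOTHESIS, never asserted.

`Ring2AbelianAllWeilFloor` isolates the unrefereed content of the Weil floor (HC for complex abelian
varieties of dimension `≤ 5`) in one hypothesis `WeilFourfoldResidual`: Weil classes are algebraic on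
every fourfold component `(2, d, δ)`, `d ∉ {1, 3}`, `δ` non-split — indexed by ALL `d ≥ 1`, although the
Weil field `ℚ(√-d) = ℚ(√-m²d)` only sees the squarefree part of `d` (referee remark R-04 on `p195792`:
"`d = 4, 12, …` is not threaded through `d ↦ d·m²`"). This file threads it through:

* `weilAlgebraicAll_sq_mul` — **`WeilAlgebraicAll n d → WeilAlgebraicAll n (m²d)`** (`m ≥ 1`), by the
  isogeny `p : A → B = A/φ'(A[m])`, `f ∘ p = [m]`, `ψ = φ'/m ∈ End B` of
  `Ring2AbelianAllWeilIsogenyDescent`: a rational `(n,n)` Weil class of `(A, φ', m²d)` pulls back along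
  `f` to one of `(B, mψ, m²d) = (B, ψ, d)`, algebraic by hypothesis, and back along the flat isogeny `p`
  to `m²ⁿ` times itself (`map_mem_algebraicClasses_of_flat`).
* `weilAlgebraicAll_of_squarefree` — squarefree `d ≥ 1` suffice (`d = b²a`); the refereed columns
  propagate: `WeilAlgebraicAll 2 (m²)` from Koike 2004, `WeilAlgebraicAll 2 (3m²)` from Schoen 1998
  (each with van Geemen's Lemma 5.2 obligation `PolarizedWeilDiscriminantExists`).
* `WeilFourfoldResidualSq` — the residual restricted to SQUAREFREE `d ∉ {1, 3}` (`@[conjecture]`, a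
  hypothesis), `markmanFourfolds_of_refereed_and_residualSq`, and the floor re-assembled from it:
  `hodgeConjectureFor_abelian_dim_le_five_of_refereed_and_residualSq`; given the refereed facts and the
  two typed obligations the two residuals are equivalent (`weilFourfoldResidual_of_refereed_and_residualSq`,
  `weilFourfoldResidualSq_of_weilFourfoldResidual`).

## References

* B. Moonen, Yu. Zarhin, *Weil classes on abelian varieties*, Crelle 496 (1998), §1. [MoonenZarhin1998WeilClasses]
* B. Moonen, Yu. Zarhin, *Hodge classes on abelian varieties of low dimension*, Math. Ann. 315 (1999). [MoonenZarhin1999LowDim]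
* K. Koike, *Algebraicity of some Weil Hodge classes*, Canad. Math. Bull. 47 (2004), Rem. 2.1. [Koike2004WeilHodge]
* C. Schoen, *Addendum to: Hodge classes on self-products of a variety with an automorphism*,
  Compositio Math. 114 (1998), §10. [Schoen1998HodgeWeilAddendum]
* E. Markman, *The monodromy of generalized Kummer varieties …*, JEMS 25 (2023), Thm. 1.5. [Markman2023GeneralizedKummers]
* E. Markman, *Cycles on abelian 2n-folds of Weil type from secant sheaves on abelian n-folds*,
  arXiv:2502.03415 (2025; preprint, UNREFEREED), Thm. 1.5.1, Cor. 1.6.1. [Markman2025SecantWeil]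
* E. Markman, *Secant sheaves and Weil classes on abelian varieties* (survey), arXiv:2509.23403
  (2025; preprint), Thm. 1.2. [Markman2025SurveySecant]
-/

noncomputable section

set_option linter.dupNamespace false

open CategoryTheory
open Literature.AlgebraicGeometry Literature.AlgebraicGeometry.Motives
open Literature.AlgebraicGeometry.HodgeTheory
open Literature.AlgebraicTopology.SingularHomology
open Literature.AlgebraicGeometry.VanGeemen1994
open Summit.HodgeConjecture.HodgeConjecture.Ring2.Hypotheses
open Summit.HodgeConjecture.HodgeConjecture.Ring2.Habitat
open Summit.HodgeConjecture.HodgeConjecture.Cruxes.HodgeAbelianVarieties.EStepSecantInduction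
open Summit.HodgeConjecture.HodgeConjecture.Cruxes.HodgeAbelianVarieties.PrymCanonicalZ3SplitSeeds.Stubs.WeilSectorOffReach

namespace Summit.HodgeConjecture.HodgeConjecture.Ring2.AbelianAll

/-! ### `WeilAlgebraicAll n d → WeilAlgebraicAll n (m²d)` -/

/-- **Weil classes of discriminant `m²d` from those of discriminant `d`.** If the Hodge `(n,n)`
rational Weil classes are algebraic on every `2n`-dimensional `(B, ψ)` with `ψ² = -d`, then also on
every `(A, φ')` with `φ'² = -m²d` (`m ≥ 1`): pull back along `f : B = A/φ'(A[m]) → A`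
(`exists_isogeny_sq_descent`; `f` intertwines `φ'` and `mψ`, and the Weil plane of `(B, mψ, m²d)` is
that of `(B, ψ, d)`), apply the hypothesis on `B`, and pull back along the flat isogeny `p : A → B`
(`p^* f^* = [m]^* = m²ⁿ` on `H²ⁿ ⊇ E₊ ⊔ E₋`). Research route, not a corollary: this only re-indexes
the residual hypothesis of the Weil floor by squarefree `d`. [cite: MoonenZarhin1998WeilClasses, §1]
[cite: MumfordAV1970, §7 Thm. 4 p. 72] -/
theorem weilAlgebraicAll_sq_mul {n m d : ℕ} (hm : m ≠ 0) (hW : WeilAlgebraicAll n d) :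
    WeilAlgebraicAll n (m ^ 2 * d) := by
  rcases Nat.eq_zero_or_pos d with rfl | hd
  · simpa using hW
  intro A φ' hA hφ' c' hc' hrat hhodge
  obtain ⟨B, p, f, ψ, hp, hf, hψ, hfφ⟩ := exists_isogeny_sq_descent hm hφ'
  have hB : B.dim = 2 * n := (AbelianVariety.dim_eq_of_isIsogenous_holds ⟨p, hp⟩).symm.trans hA
  -- pull back along `f : B → A`
  have hc₁W : complexBetti.map f.hom.hom.hom (2 * n) c' ∈ weilClassesOf B ψ n d := by
    rw [← weilClassesOf_zsmul_sq_mul hm hd.ne' hψ]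
    exact map_mem_weilClassesOf_of_comm f hfφ hc'
  have hc₁alg : complexBetti.map f.hom.hom.hom (2 * n) c' ∈ algebraicClasses B.X n :=
    hW B ψ hB hψ _ hc₁W (isRationalClass_complexBetti_map f.hom.hom.hom hrat)
      (hhodge.map_of_isSmoothProjective (isSmoothProjective_of_dim_eq' hB)
        (isSmoothProjective_of_dim_eq' hA) f.hom.hom.hom)
  -- pull back along the flat isogeny `p : A → B`: `p^* f^* c' = m²ⁿ c'`
  haveI : AlgebraicGeometry.Flat (AbelianVariety.Hom.toSchemeHom p) := hp.flat
  have hc₂alg := map_mem_algebraicClasses_of_flat p.hom.hom.hom hc₁alg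
  have hkey : complexBetti.map p.hom.hom.hom (2 * n) (complexBetti.map f.hom.hom.hom (2 * n) c') =
      ((m : ℂ) ^ (2 * n)) • c' := by
    change singularCohomology.map ℂ ℂ (Motives.AlgPoints.mapContinuous (L := ℂ) p.hom.hom.hom) (2 * n)
      (singularCohomology.map ℂ ℂ (Motives.AlgPoints.mapContinuous (L := ℂ) f.hom.hom.hom)
        (2 * n) c') = _
    rw [map_map_apply_of_hom, hf]
    exact map_zsmul_id_of_mem_weilClassesOf m hc'
  rw [hkey] at hc₂alg
  have hmn : ((m : ℂ) ^ (2 * n)) ≠ 0 := pow_ne_zero _ (Nat.cast_ne_zero.mpr hm)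
  have h' := (algebraicClasses A.X n).smul_mem (((m : ℂ) ^ (2 * n))⁻¹) hc₂alg
  rwa [smul_smul, inv_mul_cancel₀ hmn, one_smul] at h'

/-- **Squarefree discriminants suffice**: `WeilAlgebraicAll n d` for all squarefree `d ≥ 1` gives it
for all `d ≥ 1` (`d = b² a`, `a` squarefree: `Nat.sq_mul_squarefree_of_pos`).
[cite: MoonenZarhin1998WeilClasses, §1] -/
theorem weilAlgebraicAll_of_squarefree {n : ℕ}
    (h : ∀ d : ℕ, 0 < d → Squarefree d → WeilAlgebraicAll n d) :
    ∀ d : ℕ, 0 < d → WeilAlgebraicAll n d := by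
  intro d hd
  obtain ⟨a, b, ha, hb, rfl, hsq⟩ := Nat.sq_mul_squarefree_of_pos hd
  exact weilAlgebraicAll_sq_mul hb.ne' (h a ha hsq)

/-- **The two refereed columns propagate up the squares.** `WeilAlgebraicAll 2 (m²)` (`K = ℚ(i)`:
`d = 1, 4, 9, 16, …`) from Koike 2004 (refereed) and van Geemen's Lemma 5.2 obligation — the cells
`d = 4, 9, …` of the atlas are NOT residual (referee remark R-04). [cite: Koike2004WeilHodge, Rem. 2.1]
[cite: vanGeemen1994HodgeAV, Lemma 5.2 (1)–(3)] -/
theorem weilAlgebraicAll_two_sq_of_koike2004 (hK : Koike2004_weilClasses_algebraic_hyperbolicSixfold_one)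
    (hE : PolarizedWeilDiscriminantExists) {m : ℕ} (hm : m ≠ 0) : WeilAlgebraicAll 2 (m ^ 2) := by
  simpa using weilAlgebraicAll_sq_mul hm
    (weilAlgebraicAll_two_of_components hE one_pos (weilClassesComponent_two_one_of_koike2004 hK))

/-- `WeilAlgebraicAll 2 (3m²)` (`K = ℚ(√-3)`: `d = 3, 12, 27, …`) from Schoen 1998 (refereed) and van
Geemen's Lemma 5.2 obligation. [cite: Schoen1998HodgeWeilAddendum, §10]
[cite: vanGeemen1994HodgeAV, Lemma 5.2 (1)–(3)] -/
theorem weilAlgebraicAll_two_sq_mul_three_of_schoen1998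
    (hS : Schoen1998_weilClasses_algebraic_hyperbolicSixfold_three)
    (hE : PolarizedWeilDiscriminantExists) {m : ℕ} (hm : m ≠ 0) : WeilAlgebraicAll 2 (m ^ 2 * 3) :=
  weilAlgebraicAll_sq_mul hm
    (weilAlgebraicAll_two_of_components hE (by norm_num) (weilClassesComponent_two_three_of_schoen1998 hS))

/-- Cells `(2, m²d, δ)`, every `δ`, from the unpolarized slice at `d`. [cite: vanGeemen1994HodgeAV, Lemma 5.2 (3)] -/
theorem weilClassesComponent_two_sq_mul_of_weilAlgebraicAll {m d : ℕ} (hm : m ≠ 0)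
    (h : WeilAlgebraicAll 2 d) (δ : weilNormResidueGroup (m ^ 2 * d)) :
    WeilClassesComponent 2 (m ^ 2 * d) δ :=
  weilClassesComponent_two_of_weilAlgebraicAll (weilAlgebraicAll_sq_mul hm h) δ

/-! ### The Weil floor with the residual indexed by squarefree `d` -/

/-- **The squarefree residual of the Weil-fourfold row.** Weil classes are algebraic on every member of
every fourfold component `(2, d, δ)` with `d` SQUAREFREE, `d ∉ {1, 3}`, and `δ` not the split class:
the part of Markman's fourfold statement that no refereed source and no kernel theorem covers, now
indexed by the Weil FIELD `ℚ(√-d)` rather than by `d`. A HYPOTHESIS; never asserted. Research route,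
not a corollary. [cite: Markman2025SecantWeil, Cor. 1.6.1 (preprint, unrefereed)]
[cite: Markman2025SurveySecant, Thm. 1.2 (preprint)] [status: open] -/
@[conjecture] def WeilFourfoldResidualSq : Prop :=
  ∀ d : ℕ, 0 < d → Squarefree d → d ≠ 1 → d ≠ 3 → ∀ δ : weilNormResidueGroup d,
    δ ≠ splitDiscriminantClass 2 d → WeilClassesComponent 2 d δ

/-- The old residual implies the squarefree one (a sub-family of cells). [folklore] -/
theorem weilFourfoldResidualSq_of_weilFourfoldResidual (hR : WeilFourfoldResidual) :
    WeilFourfoldResidualSq :=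
  fun d hd _ h1 h3 δ hδ ↦ hR d hd h1 h3 δ hδ

/-- Every fourfold component `(2, d, δ)` with `d` squarefree, from Koike 2004 (`d = 1`), Schoen 1998
(`d = 3`), Markman 2023 + Landherr (`δ` split) and the squarefree residual otherwise.
[cite: Koike2004WeilHodge, Rem. 2.1] [cite: Schoen1998HodgeWeilAddendum, §10] [cite: Markman2023GeneralizedKummers, Thm. 1.5] -/
theorem weilClassesComponent_two_of_refereed_and_residualSq
    (hK : Koike2004_weilClasses_algebraic_hyperbolicSixfold_one)
    (hS : Schoen1998_weilClasses_algebraic_hyperbolicSixfold_three)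
    (hL : LandherrSplitCriterion) (hM23 : Markman2023_weilClasses_algebraic_discOneWeilFourfold)
    (hR : WeilFourfoldResidualSq) {d : ℕ} (hd : 0 < d) (hsq : Squarefree d)
    (δ : weilNormResidueGroup d) : WeilClassesComponent 2 d δ := by
  by_cases h1 : d = 1
  · subst h1; exact weilClassesComponent_two_one_of_koike2004 hK δ
  by_cases h3 : d = 3
  · subst h3; exact weilClassesComponent_two_three_of_schoen1998 hS δ
  by_cases hs : δ = splitDiscriminantClass 2 d
  · subst hs; exact weilClassesComponent_split_two_of_markman2023 hL hM23 hd
  · exact hR d hd hsq h1 h3 δ hs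

/-- **Markman's fourfold STATEMENT from refereed facts + the two typed van Geemen/Landherr obligations +
the SQUAREFREE residual**: squarefree `d` by cases as before, all `d` by `weilAlgebraicAll_of_squarefree`.
[cite: Markman2025SurveySecant, Thm. 1.2 (statement only; preprint)] -/
theorem markmanFourfolds_of_refereed_and_residualSq
    (hK : Koike2004_weilClasses_algebraic_hyperbolicSixfold_one)
    (hS : Schoen1998_weilClasses_algebraic_hyperbolicSixfold_three)
    (hL : LandherrSplitCriterion) (hM23 : Markman2023_weilClasses_algebraic_discOneWeilFourfold)
    (hE : PolarizedWeilDiscriminantExists) (hR : WeilFourfoldResidualSq) :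
    Markman2025_weilClasses_algebraic_abelianFourfold :=
  weilAlgebraicAll_two_iff_markman.1 (weilAlgebraicAll_of_squarefree fun _d hd hsq ↦
    weilAlgebraicAll_two_of_components hE hd
      (weilClassesComponent_two_of_refereed_and_residualSq hK hS hL hM23 hR hd hsq))

/-- Given the refereed facts and the two typed obligations, the squarefree residual gives back the
old one. [folklore] -/
theorem weilFourfoldResidual_of_refereed_and_residualSq
    (hK : Koike2004_weilClasses_algebraic_hyperbolicSixfold_one)
    (hS : Schoen1998_weilClasses_algebraic_hyperbolicSixfold_three)
    (hL : LandherrSplitCriterion) (hM23 : Markman2023_weilClasses_algebraic_discOneWeilFourfold)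
    (hE : PolarizedWeilDiscriminantExists) (hR : WeilFourfoldResidualSq) : WeilFourfoldResidual :=
  weilFourfoldResidual_of_markmanFourfolds (markmanFourfolds_of_refereed_and_residualSq hK hS hL hM23 hE hR)

/-- **THE WEIL FLOOR with the squarefree residual**: the Hodge conjecture for every complex abelian variety
of dimension `≤ 5` from the refereed named facts (Moonen–Zarhin 1999, Koike 2004, Schoen 1998, Markman
2023), the typed van Geemen 5.2 / Landherr obligations, and `WeilFourfoldResidualSq`. `HC_CM` absent; no
minimality claimed; research route, not a corollary. [cite: MoonenZarhin1999LowDim, Thm. 0.1, 0.2 and (2.7)]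
[cite: Markman2023GeneralizedKummers, Thm. 1.5] [cite: Schoen1998HodgeWeilAddendum, §10] [cite: Koike2004WeilHodge, Rem. 2.1] -/
theorem hodgeConjectureFor_abelian_dim_le_five_of_refereed_and_residualSq
    (hred : MoonenZarhin1999_hodgeClasses_abelian_dim_le_five_of_weilClassesFourfolds)
    (hK : Koike2004_weilClasses_algebraic_hyperbolicSixfold_one)
    (hS : Schoen1998_weilClasses_algebraic_hyperbolicSixfold_three)
    (hL : LandherrSplitCriterion) (hM23 : Markman2023_weilClasses_algebraic_discOneWeilFourfold)
    (hE : PolarizedWeilDiscriminantExists) (hR : WeilFourfoldResidualSq)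
    (A : AbelianVariety ℂ) (hA : A.dim ≤ 5) : HodgeConjectureFor A.dim A.X :=
  hodgeConjectureFor_abelian_dim_le_five_of_refereed_and_residual hred hK hS hL hM23 hE
    (weilFourfoldResidual_of_refereed_and_residualSq hK hS hL hM23 hE hR) A hA

/-- Upper bound: the squarefree residual is an instance of the Hodge conjecture. [cite: Deligne2000, §1] -/
theorem weilFourfoldResidualSq_of_hodgeConjecture (h : _root_.HodgeConjecture) : WeilFourfoldResidualSq :=
  weilFourfoldResidualSq_of_weilFourfoldResidual (weilFourfoldResidual_of_hodgeConjecture h)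

end Summit.HodgeConjecture.HodgeConjecture.Ring2.AbelianAll

end
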